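import Summits.RiemannHypothesis.RiemannHypothesis.Theses.SpectralTrace
import Summits.RiemannHypothesis.RiemannHypothesis.Theorems.WindowTracePrime2.Negative.Poisson
import Summits.RiemannHypothesis.RiemannHypothesis.Theorems.WindowTracePrime2.Negative.BumpPositivity

/-!
# No finite union of arithmetic progressions realises a window trace

Negative-side support for crux `SpectralTrace.WindowTracePrime2` (stmt-RiemannHypothesis-11196;
cdisprove seat refuter-cdisprove-stmt-RiemannHypothesis-11196-0). Write `Trace(A)` for the window
identity `∀ g, IsWeilTest g → tsupport g ⊆ [-A, A] → HasSum (fun i ↦ ĝ(1/2+iγ_i)) (W g)` of a real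
family `γ` (kept INLINE below; the crux is `∃ ι γ, Trace(log 3)`).

* `not_trace_progressions` — if `[u, v] ⊆ [1/2, A]` (`u < v`) contains no `log n` (`n ≥ 2`), no
  family `γ(j, n) = α_j n + β_j` on `Fin J × ℤ` (`α_j ≠ 0`) satisfies `Trace(A)`: a non-negative bump
  between the finitely many dual-lattice points `2πk/α_j` in `(u, v)` has all progression sums `0`
  by Poisson summation (`tsum_lineSample_eq_zero'`, `Negative/Poisson.lean`) but `Re W > 0`
  (`weilFunctional_bumpC_re_pos`, `Negative/BumpPositivity.lean`).
* `not_windowTracePrime2_progressions`, `not_windowTracePrime2_progression` (one progression,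
  `ι = ℤ`) — the crux window `log 3`, via the prime-free interval `[0.7, 1]`;
  `not_windowTraceArch_progressions` — the archimedean rung `log 2`, via `[1/2, 0.69]`.
  Every witness of either rung is aperiodic at every scale.
-/

noncomputable section

open Complex Filter Set MeasureTheory
open scoped Real Topology

namespace Summit.RiemannHypothesis.RiemannHypothesis.Theorems.WindowTracePrime2.Negative

open Literature.NumberTheory.LFunctions
open Summit.RiemannHypothesis.RiemannHypothesis.Theses.SpectralTrace

/-- The lattice points `2πk/α` (`k : ℤ`) lying in a bounded interval form a finite set. -/
theorem finite_lattice_inter {α : ℝ} (hα : α ≠ 0) (u v : ℝ) :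
    {x : ℝ | x ∈ Set.Ioo u v ∧ ∃ k : ℤ, x = 2 * π * k / α}.Finite := by
  set R : ℝ := max |u| |v| * |α| / (2 * π) with hR
  have hαpos : 0 < |α| := abs_pos.2 hα
  have h2π : (0 : ℝ) < 2 * π := by positivity
  refine ((Set.finite_Icc (-⌈R⌉) ⌈R⌉).image fun k : ℤ => 2 * π * (k : ℝ) / α).subset ?_
  rintro x ⟨hx, k, rfl⟩
  refine ⟨k, ?_, rfl⟩
  have hxabs : |2 * π * (k : ℝ) / α| ≤ max |u| |v| := by
    refine abs_le.2 ⟨?_, ?_⟩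
    · linarith [hx.1, neg_abs_le u, le_max_left |u| |v|]
    · linarith [hx.2, le_abs_self v, le_max_right |u| |v|]
  have hk : |(k : ℝ)| ≤ R := by
    rw [abs_div, abs_mul, abs_of_pos h2π, div_le_iff₀ hαpos] at hxabs
    rw [hR, le_div_iff₀ h2π]
    linarith
  have hk' := abs_le.1 hk
  simp only [Set.mem_Icc]
  constructor
  · have : (-(⌈R⌉ : ℤ) : ℝ) ≤ k := by linarith [Int.le_ceil R]
    exact_mod_cast this
  · have : (k : ℝ) ≤ (⌈R⌉ : ℤ) := hk'.2.trans (Int.le_ceil R)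
    exact_mod_cast this

/-- **No finite union of arithmetic progressions realises a window.** If `[u, v] ⊆ [1/2, A]`
(`u < v`) contains no `log n` (`n ≥ 2`), then no family `γ(j, n) = α_j n + β_j` on `Fin J × ℤ`
(`α_j ≠ 0`) satisfies `Trace A`. Proof: pick a non-negative bump `g` inside `(u, v)` avoiding the
finitely many dual-lattice points `2πk/α_j`; by Poisson summation every progression contributes
`(2π/α_j) Σ_k e^{2πikβ_j/α_j} g(2πk/α_j) = 0` (`tsum_lineSample_eq_zero'`), so the family's sum is
`0`, while `Re W(g) > 0` (`weilFunctional_bumpC_re_pos`). -/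
theorem not_trace_progressions {A u v : ℝ} (hu : 1 / 2 ≤ u) (huv : u < v) (hvA : v ≤ A)
    (hlog : ∀ n : ℕ, 2 ≤ n → Real.log n ∉ Set.Icc u v)
    {J : ℕ} (α β : Fin J → ℝ) (hα : ∀ j, α j ≠ 0) :
    ¬ (∀ g : ℝ → ℂ, IsWeilTest g → tsupport g ⊆ Set.Icc (-A) (A) →
        HasSum (fun p : Fin J × ℤ => weilMellin g (1 / 2 + ((α p.1 * p.2 + β p.1 : ℝ) : ℂ) * Complex.I)) (weilFunctional g)) := by
  intro hT
  -- bad points: the dual-lattice points of the `J` progressions inside `(u, v)`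
  set P : Set ℝ := ⋃ j : Fin J, {x : ℝ | x ∈ Set.Ioo u v ∧ ∃ k : ℤ, x = 2 * π * k / α j} with hP
  have hPfin : P.Finite := Set.finite_iUnion fun j => finite_lattice_inter (hα j) u v
  -- a point of `(u, v)` off `P`, with a ball around it
  have hU : IsOpen (Set.Ioo u v \ P) := isOpen_Ioo.sdiff hPfin.isClosed
  obtain ⟨x, hx⟩ : (Set.Ioo u v \ P).Nonempty := ((Set.Ioo_infinite huv).sdiff hPfin).nonempty
  obtain ⟨ε, hε, hball⟩ := Metric.isOpen_iff.1 hU x hx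
  -- the bump centred at `x`, radius `ε/2`
  let b : ContDiffBump x := ⟨ε / 4, ε / 2, by positivity, by linarith⟩
  have hrOut : b.rOut = ε / 2 := rfl
  have hIcc : Set.Icc (x - b.rOut) (x + b.rOut) ⊆ Set.Ioo u v \ P := by
    intro y hy
    apply hball
    rw [Metric.mem_ball, Real.dist_eq, abs_lt]
    rw [hrOut] at hy
    constructor <;> linarith [hy.1, hy.2]
  have hc : 1 / 2 ≤ x - b.rOut := by
    have h1 := (hIcc ⟨le_rfl, by linarith [b.rOut_pos]⟩).1.1
    linarith
  have hlog' : ∀ n : ℕ, 2 ≤ n → Real.log n ∉ Set.Icc (x - b.rOut) (x + b.rOut) :=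
    fun n hn h => hlog n hn (Set.Ioo_subset_Icc_self (hIcc h).1)
  -- the complexified bump, kept opaque
  set g : ℝ → ℂ := fun t => ((b t : ℝ) : ℂ) with hg_def
  have hgb : ∀ t, g t = ((b t : ℝ) : ℂ) := fun t => rfl
  have hg : IsWeilTest g := isWeilTest_bumpC b hgb
  have hsupp : tsupport g ⊆ Set.Icc (-A) A := by
    refine (tsupport_bumpC b hgb).trans fun y hy => ?_
    have hy' := (hIcc hy).1
    constructor <;> linarith [hy'.1, hy'.2]
  have hsum := hT g hg hsupp
  -- `g` vanishes on every dual lattice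
  have hzero : ∀ j : Fin J, ∀ k : ℤ, g (2 * π * k / α j) = 0 := by
    intro j k
    apply bumpC_eq_zero b hgb
    intro hmem
    have h1 := hIcc hmem
    exact h1.2 (Set.mem_iUnion.2 ⟨j, h1.1, k, rfl⟩)
  -- each progression contributes `0`
  have hfib : ∀ j : Fin J,
      HasSum (fun n : ℤ => weilMellin g (1 / 2 + ((α j * n + β j : ℝ) : ℂ) * I)) 0 := by
    intro j
    have hs0 := hsum.summable.comp_injective (Prod.mk_right_injective j)
    have hs : Summable fun n : ℤ => weilMellin g (1 / 2 + ((α j * n + β j : ℝ) : ℂ) * I) := by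
      refine hs0.congr fun n => ?_
      simp only [Function.comp_apply]
    have h0 : ∑' n : ℤ, weilMellin g (1 / 2 + ((α j * n + β j : ℝ) : ℂ) * I) = 0 :=
      tsum_lineSample_eq_zero' hg (hα j) (β j) (hzero j)
    rw [← h0]
    exact hs.hasSum
  have hW : HasSum (fun _ : Fin J => (0 : ℂ)) (weilFunctional g) :=
    HasSum.prod_fiberwise
      (f := fun p : Fin J × ℤ => weilMellin g (1 / 2 + ((α p.1 * p.2 + β p.1 : ℝ) : ℂ) * I))
      (g := fun _ : Fin J => (0 : ℂ)) hsum hfib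
  have hW0 : weilFunctional g = 0 := hW.unique hasSum_zero
  have hpos := weilFunctional_bumpC_re_pos b hgb hc hlog'
  rw [hW0, Complex.zero_re] at hpos
  exact lt_irrefl 0 hpos

/-- The interval `[0.7, 1]` contains no `log n`, `n ≥ 2` (`log 2 < 0.694`, `log 3 > 1`). -/
theorem log_notMem_Icc (n : ℕ) (hn : 2 ≤ n) : Real.log n ∉ Set.Icc (0.7 : ℝ) 1 := by
  intro h
  rcases Nat.lt_or_ge n 3 with h3 | h3
  · interval_cases n
    have := Real.log_two_lt_d9
    norm_num at this h
    linarith [h.1]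
  · have h3' : (3 : ℝ) ≤ n := by exact_mod_cast h3
    have hlog3 : 1 < Real.log 3 := (Real.lt_log_iff_exp_lt (by norm_num)).mpr Real.exp_one_lt_three
    have := Real.log_le_log (by norm_num) h3'
    linarith [h.2]

/-- **The crux has no witness made of finitely many arithmetic progressions**
(`γ(j, n) = α_j n + β_j`, any slopes `α_j ≠ 0`, any shifts, any `J`). -/
theorem not_windowTracePrime2_progressions {J : ℕ} (α β : Fin J → ℝ) (hα : ∀ j, α j ≠ 0) :
    ¬ (∀ g : ℝ → ℂ, IsWeilTest g → tsupport g ⊆ Set.Icc (-Real.log 3) (Real.log 3) →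
        HasSum (fun p : Fin J × ℤ => weilMellin g (1 / 2 + ((α p.1 * p.2 + β p.1 : ℝ) : ℂ) * Complex.I)) (weilFunctional g)) :=
  not_trace_progressions (u := 0.7) (v := 1) (by norm_num) (by norm_num)
    ((Real.lt_log_iff_exp_lt (by norm_num)).mpr Real.exp_one_lt_three).le
    log_notMem_Icc α β hα

/-- In particular NO SINGLE ARITHMETIC PROGRESSION `γ_n = αn + β` (`α ≠ 0`) is a witness of the
crux (the case the route's text starts from: a lattice reproduces only `c·δ`'s on the window). -/
theorem not_windowTracePrime2_progression (α β : ℝ) (hα : α ≠ 0) :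
    ¬ (∀ g : ℝ → ℂ, IsWeilTest g → tsupport g ⊆ Set.Icc (-Real.log 3) (Real.log 3) →
        HasSum (fun n : ℤ => weilMellin g (1 / 2 + ((α * n + β : ℝ) : ℂ) * Complex.I)) (weilFunctional g)) := fun h =>
  not_windowTracePrime2_progressions (fun _ => α) (fun _ => β) (fun _ => hα) fun g hg hsupp => by
    have h1 := ((Equiv.uniqueProd ℤ (Fin 1)).hasSum_iff
      (f := fun n : ℤ => weilMellin g (1 / 2 + ((α * n + β : ℝ) : ℂ) * Complex.I))).2 (h g hg hsupp)
    simpa only [Function.comp_def, Equiv.uniqueProd_apply] using h1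

/-- The same for the archimedean rung `WindowTraceArch` (`A = log 2`), via the prime-free interval
`[1/2, 0.69]`. -/
theorem log_notMem_Icc' (n : ℕ) (hn : 2 ≤ n) : Real.log n ∉ Set.Icc (1 / 2 : ℝ) 0.69 := by
  intro h
  have h2 : (2 : ℝ) ≤ n := by exact_mod_cast hn
  have := Real.log_le_log (by norm_num) h2
  have h2' := Real.log_two_gt_d9
  norm_num at h2' h
  linarith [h.2]

/-- **No finite union of arithmetic progressions realises the archimedean rung** (`A = log 2`). -/
theorem not_windowTraceArch_progressions {J : ℕ} (α β : Fin J → ℝ) (hα : ∀ j, α j ≠ 0) :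
    ¬ (∀ g : ℝ → ℂ, IsWeilTest g → tsupport g ⊆ Set.Icc (-Real.log 2) (Real.log 2) →
        HasSum (fun p : Fin J × ℤ => weilMellin g (1 / 2 + ((α p.1 * p.2 + β p.1 : ℝ) : ℂ) * Complex.I)) (weilFunctional g)) := by
  refine not_trace_progressions (u := 1 / 2) (v := 0.69) le_rfl (by norm_num) ?_ log_notMem_Icc' α β hα
  have := Real.log_two_gt_d9
  norm_num at this ⊢
  linarith

end Summit.RiemannHypothesis.RiemannHypothesis.Theorems.WindowTracePrime2.Negative

end
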